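import Summits.NavierStokesRegularity.NavierStokesRegularity.Theorems.TaoLadderRungTwoFlatHopTubeCanonical
import HarnessLib

/-!
# Tao ladder, rung two (flat lattice) — hop-tube frame: the anchored energy identity (cell theory-1 g41, L-53d)

PROVENANCE (p1 g22): theory-1 g41's image of record numT53/AnchoredEnergy53.lean sha16 0d1723b110021eab (farm `lean check` rc 0 · 0 sorry · 0 warnings),
landed with declarations BYTE-IDENTICAL (helper for the K_A♭ parent item stmt-NavierStokesRegularity-22987); the image's module
docstring follows verbatim.

MODEL-lattice bookkeeping only; nothing here is about the Navier–Stokes equations and nothing is certified numerically.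

RULING R53-1 (LADDER §53.4) budgets the tube reference's OWN carrier shortfall `(1 − R_ref)⁺` over one hop.  On the
model lattice the (graded) cascade flow conserves the energy `Σ X²` exactly and the one-site shift is a bijection of
`ℤ`, so the shortfall is controlled by the reference's anchored one-hop DEFECT `d` (landed-and-shifted state `= R·u⋆ + d`)
through pure algebra — first order in `d`, with NO perturbation from the flat pulse (which would be first order in `ε₀`
with a large coefficient, LADDER §53.2).  This file is that algebra over an arbitrary finite window `s : Finset ι`:

* `anchored_energy_expand` — `Σ(x'u+e')² − Σ(xu+e)² = (x'²−x²)Σu² + 2(x'Σue' − xΣue) + (Σe'² − Σe²)`;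
* `anchored_ratio_sq_bound` — equal energies ⇒ `|x'² − x²|·Σu² ≤ 2|x'||Σue'| + 2|x||Σue| + Σe'² + Σe²`;
* `ref_ratio_sq_bound`, `ref_shortfall_bound` — the reference's own hop (`x = 1`, `e = 0`):
  `|R² − 1|·Σu² ≤ 2|R||Σud| + Σd²` and, for `R ≥ 0`, `(1 − R)·Σu² ≤ 2|R||Σud| + Σd²`.

The flow-side inputs (exact conservation for the graded model flow, the decomposition of the landed state) are p1's.
[cite: Tao2016AveragedNS, §6.1 (energy identity of the cascade, statement shape); cell LADDER §53.4 (R53-1, L-53d)]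
-/

set_option linter.dupNamespace false

namespace Summit.NavierStokesRegularity.NavierStokesRegularity.Theorems.HopTube

open Finset

section AnchoredEnergy

variable {ι : Type*} (s : Finset ι)

/-- Expansion of the energy difference of two anchored decompositions `x'·u + e'`, `x·u + e` over a finite window.
[folklore] -/
theorem anchored_energy_expand (u e e' : ι → ℝ) (x x' : ℝ) :
    ∑ i ∈ s, (x' * u i + e' i) ^ 2 - ∑ i ∈ s, (x * u i + e i) ^ 2
      = (x' ^ 2 - x ^ 2) * ∑ i ∈ s, u i ^ 2
        + 2 * (x' * ∑ i ∈ s, u i * e' i - x * ∑ i ∈ s, u i * e i)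
        + (∑ i ∈ s, e' i ^ 2 - ∑ i ∈ s, e i ^ 2) := by
  have h1 : ∑ i ∈ s, (x' * u i + e' i) ^ 2
      = x' ^ 2 * ∑ i ∈ s, u i ^ 2 + 2 * x' * ∑ i ∈ s, u i * e' i + ∑ i ∈ s, e' i ^ 2 := by
    rw [Finset.mul_sum, Finset.mul_sum, ← Finset.sum_add_distrib, ← Finset.sum_add_distrib]
    exact Finset.sum_congr rfl fun i _ => by ring
  have h2 : ∑ i ∈ s, (x * u i + e i) ^ 2
      = x ^ 2 * ∑ i ∈ s, u i ^ 2 + 2 * x * ∑ i ∈ s, u i * e i + ∑ i ∈ s, e i ^ 2 := by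
    rw [Finset.mul_sum, Finset.mul_sum, ← Finset.sum_add_distrib, ← Finset.sum_add_distrib]
    exact Finset.sum_congr rfl fun i _ => by ring
  rw [h1, h2]; ring

/-- EQUAL ENERGIES bound the change of the squared anchor coordinate by the cross terms and the deviation energies:
`|x'² − x²|·Σu² ≤ 2|x'||Σue'| + 2|x||Σue| + Σe'² + Σe²`. [folklore] -/
theorem anchored_ratio_sq_bound (u e e' : ι → ℝ) (x x' : ℝ)
    (h : ∑ i ∈ s, (x' * u i + e' i) ^ 2 = ∑ i ∈ s, (x * u i + e i) ^ 2) :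
    |x' ^ 2 - x ^ 2| * ∑ i ∈ s, u i ^ 2
      ≤ 2 * |x'| * |∑ i ∈ s, u i * e' i| + 2 * |x| * |∑ i ∈ s, u i * e i|
        + ∑ i ∈ s, e' i ^ 2 + ∑ i ∈ s, e i ^ 2 := by
  have hexp := anchored_energy_expand s u e e' x x'
  rw [h, sub_self] at hexp
  set U := ∑ i ∈ s, u i ^ 2 with hUdef
  set A := ∑ i ∈ s, u i * e i
  set A' := ∑ i ∈ s, u i * e' i
  set E := ∑ i ∈ s, e i ^ 2 with hEdef
  set E' := ∑ i ∈ s, e' i ^ 2 with hE'def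
  have hU : 0 ≤ U := Finset.sum_nonneg fun i _ => sq_nonneg _
  have hE : 0 ≤ E := Finset.sum_nonneg fun i _ => sq_nonneg _
  have hE' : 0 ≤ E' := Finset.sum_nonneg fun i _ => sq_nonneg _
  have c1 : x' * A' ≤ |x'| * |A'| := by rw [← abs_mul]; exact le_abs_self _
  have c2 : -(|x'| * |A'|) ≤ x' * A' := by rw [← abs_mul]; exact neg_abs_le _
  have c3 : x * A ≤ |x| * |A| := by rw [← abs_mul]; exact le_abs_self _
  have c4 : -(|x| * |A|) ≤ x * A := by rw [← abs_mul]; exact neg_abs_le _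
  have h1 : |x' ^ 2 - x ^ 2| * U = |(x' ^ 2 - x ^ 2) * U| := by rw [abs_mul, abs_of_nonneg hU]
  rw [h1]
  refine abs_le.mpr ⟨?_, ?_⟩ <;> linarith

/-- THE REFERENCE'S OWN HOP (`x = 1`, `e = 0`; landed-and-shifted state `R·u + d`): exact energy conservation gives
`|R² − 1|·Σu² ≤ 2|R|·|Σud| + Σd²` — first order in the one-hop defect `d`, no perturbation from the flat pulse.
[folklore; cell LADDER §53.4 (L-53d)] -/
theorem ref_ratio_sq_bound (u d : ι → ℝ) (R : ℝ)
    (h : ∑ i ∈ s, (R * u i + d i) ^ 2 = ∑ i ∈ s, u i ^ 2) :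
    |R ^ 2 - 1| * ∑ i ∈ s, u i ^ 2 ≤ 2 * |R| * |∑ i ∈ s, u i * d i| + ∑ i ∈ s, d i ^ 2 := by
  have h' : ∑ i ∈ s, (R * u i + d i) ^ 2 = ∑ i ∈ s, (1 * u i + (fun _ => (0 : ℝ)) i) ^ 2 := by
    rw [h]; exact Finset.sum_congr rfl fun i _ => by ring
  have := anchored_ratio_sq_bound s u (fun _ => (0 : ℝ)) d 1 R h'
  simpa using this

/-- The carrier SHORTFALL form consumed by R53-1's budget: for `R ≥ 0`,
`(1 − R)·Σu² ≤ 2|R|·|Σud| + Σd²`. [folklore; cell LADDER §53.4 (L-53d)] -/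
theorem ref_shortfall_bound (u d : ι → ℝ) {R : ℝ} (hR : 0 ≤ R)
    (h : ∑ i ∈ s, (R * u i + d i) ^ 2 = ∑ i ∈ s, u i ^ 2) :
    (1 - R) * ∑ i ∈ s, u i ^ 2 ≤ 2 * |R| * |∑ i ∈ s, u i * d i| + ∑ i ∈ s, d i ^ 2 := by
  have hb := ref_ratio_sq_bound s u d R h
  have hU : 0 ≤ ∑ i ∈ s, u i ^ 2 := Finset.sum_nonneg fun i _ => sq_nonneg _
  have hle : 1 - R ≤ |R ^ 2 - 1| := by
    rcases le_or_gt R 1 with h1 | h1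
    · have : |R ^ 2 - 1| = 1 - R ^ 2 := by
        rw [abs_of_nonpos (by nlinarith)]; ring
      rw [this]; nlinarith
    · linarith [abs_nonneg (R ^ 2 - 1)]
  exact (mul_le_mul_of_nonneg_right hle hU).trans hb

end AnchoredEnergy

end Summit.NavierStokesRegularity.NavierStokesRegularity.Theorems.HopTube
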